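import Literature.MathematicalPhysics.KineticTheory.KickMatchedHardSphereGasPieces
import Literature.MathematicalPhysics.KineticTheory.KickMatchedCollisionTimes
import Literature.MathematicalPhysics.KineticTheory.KickMatchedAdmissibleFlux
import HarnessLib

/-!
# The collision sum of the kick-matched gas `Z*` as a finite sum over collision indices; geometry of one kick

Topic `Literature/MathematicalPhysics/KineticTheory`; companion of `KickMatchedHardSphereGas(Pieces)` and of
`KickMatchedCollisionTimes` (crux `stmt-AtomisticToContinuum-13914`, line `stein-lindeberg-kick-swap`, stub S1
`FairGasContactChaos`, pieces FIN and M). Specialisation of the pathwise dictionary of `KickMatchedCollisionTimes` to the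
kick-matched rule `kmRule`:

* geometry of one kick (continuing `KickMatchedAdmissibleFlux.kickAt_apply_fst`, `sepVec_self`): `sepVec_kickAt` (the kicked pair `(i, j)` has separation vector `ε ω`, so it sits at exact
  contact), `kickAt_apply_snd` (outgoing velocities = specular reflection about `ω`), `markAt_of_eq_kickAt` (the mark
  read on a kicked configuration is `(ω, v, w)`: the resampled normal and the PRE-collisional velocities, recovered by
  `reflectVel_reflectVel`), `norm_kmNormal`;
* `kmRule_mem_hardSphereDomain`, `kmRule_mem_contactSet`, `stateAfter_kmRule_mem_hardSphereDomain`,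
  `exists_stateAfter_succ_mem_contactSet`: hypothesis (H4) of the dictionary holds for `Z*` for EVERY dice sequence;
* `collSum_kmFlow_eq_sum` / `collSum_starPath_eq_sum`: under (H1) no accumulation, (H2) no grazing touch inside a
  flight, (H3) no two collisions at one instant, for a datum in the domain and off contact, the defect's collision sum
  `collSum σ N τ (Z*) F` equals `ε/(N+1) ∑_{k < count τ}` of the summand at `(t_{k+1}, z_{k+1})` — the form in which
  the mark piece `markPiece` of `defect_eq_pieces` is a martingale transform in the dice;
  `finite_collisionTimes_kmFlow_inter_Icc`: the finiteness hypothesis of `defect_eq_pieces`.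

References: C. Cercignani, R. Illner, M. Pulvirenti, *The Mathematical Theory of Dilute Gases* (1994), App. 4.A
[CIP1994]; I. Gallagher, L. Saint-Raymond, B. Texier, *From Newton to Boltzmann* (2013), §4.1 [GST2013]. Elementary
bookkeeping, tagged `[folklore]`.
-/

noncomputable section

open scoped BigOperators ENNReal Topology RealInnerProductSpace
open MeasureTheory Set Filter
open Literature.Analysis.FluidPDE

namespace Literature.MathematicalPhysics.KineticTheory

namespace KickMatchedHardSphereGas

variable {σ : ℝ} {N : ℕ}

/-- On `𝕋³`, the minimal-image separation from `x` to `x + v` is `-v` for `‖v‖ < 1/2`. [folklore] -/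
theorem sepVec_self_translate (x : T3) {v : V3} (hv : ‖v‖ < 1 / 2) : geo.sepVec x (geo.translate x v) = -v := by
  have h := Torus.sepVec_translate_of_norm_lt (d := Fin 3) (x := x) (y := x) (a := 0) (b := v)
    (by rwa [sepVec_self, norm_zero, zero_add, zero_sub, norm_neg])
  rwa [Geometry.translate_zero, sepVec_self, zero_add, zero_sub] at h

/-- A kick does not move the centre `i`. [folklore] -/
theorem kickAt_apply_fst_left {i j : Fin (N + 1)} (hij : i ≠ j) (ω : V3) (y : Cfg N) :
    ((kickAt σ N i j ω y) i).1 = (y i).1 := by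
  unfold kickAt
  rw [collidePair_apply_fst, Function.update_of_ne hij]

/-- A kick re-places the partner `j` at `x_i - ε ω`. [folklore] -/
theorem kickAt_apply_fst_right (i j : Fin (N + 1)) (ω : V3) (y : Cfg N) :
    ((kickAt σ N i j ω y) j).1 = geo.translate (y i).1 (-(hsDiameter σ N • ω)) := by
  unfold kickAt
  rw [collidePair_apply_fst, Function.update_self]

/-- **The kicked pair has separation vector `ε ω`** (unit `ω`, `0 ≤ ε < 1/2`). [folklore] -/
theorem sepVec_kickAt {i j : Fin (N + 1)} (hij : i ≠ j) {ω : V3} (hω : ‖ω‖ = 1) (hε : 0 ≤ hsDiameter σ N)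
    (hε2 : hsDiameter σ N < 2⁻¹) (y : Cfg N) :
    geo.sepVec ((kickAt σ N i j ω y) i).1 ((kickAt σ N i j ω y) j).1 = hsDiameter σ N • ω := by
  rw [kickAt_apply_fst_left hij, kickAt_apply_fst_right, sepVec_self_translate, neg_neg]
  rw [norm_neg, norm_smul, Real.norm_eq_abs, abs_of_nonneg hε, hω, mul_one, one_div]
  exact hε2

/-- The kicked pair is at distance exactly `ε`. [folklore] -/
theorem norm_sepVec_kickAt {i j : Fin (N + 1)} (hij : i ≠ j) {ω : V3} (hω : ‖ω‖ = 1) (hε : 0 ≤ hsDiameter σ N)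
    (hε2 : hsDiameter σ N < 2⁻¹) (y : Cfg N) :
    ‖geo.sepVec ((kickAt σ N i j ω y) i).1 ((kickAt σ N i j ω y) j).1‖ = hsDiameter σ N := by
  rw [sepVec_kickAt hij hω hε hε2, norm_smul, Real.norm_eq_abs, abs_of_nonneg hε, hω, mul_one]

/-- **The outgoing velocities of a kick** are the specular reflection about `ω` of the incoming ones. [folklore] -/
theorem kickAt_apply_snd {i j : Fin (N + 1)} (hij : i ≠ j) {ω : V3} (hω : ‖ω‖ = 1) (hε : 0 < hsDiameter σ N)
    (hε2 : hsDiameter σ N < 2⁻¹) (y : Cfg N) :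
    (((kickAt σ N i j ω y) i).2, ((kickAt σ N i j ω y) j).2) = reflectVel ω ((y i).2, (y j).2) := by
  have hsep : geo.sepVec (y i).1 (geo.translate (y i).1 (-(hsDiameter σ N • ω))) = hsDiameter σ N • ω := by
    rw [sepVec_self_translate, neg_neg]
    rw [norm_neg, norm_smul, Real.norm_eq_abs, abs_of_nonneg hε.le, hω, mul_one, one_div]
    exact hε2
  unfold kickAt
  rw [collidePair_apply_left hij, collidePair_apply_right, Function.update_self, Function.update_of_ne hij, hsep,
    reflectVel_smul hε.ne']

/-- **The mark read on a kicked configuration is `(ω, v, w)`**: the impact vector is the kick `ω` and the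
pre-collisional velocities are recovered by reflecting back (`reflectVel_reflectVel`). [folklore] -/
theorem markAt_of_eq_kickAt {γ : ℝ → Cfg N} {s : ℝ} {i j : Fin (N + 1)} (hij : i ≠ j) {ω : V3} (hω : ‖ω‖ = 1)
    (hε : 0 < hsDiameter σ N) (hε2 : hsDiameter σ N < 2⁻¹) {y : Cfg N} (h : γ s = kickAt σ N i j ω y) :
    markAt σ N γ s i j = (ω, (y i).2, (y j).2) := by
  unfold markAt
  rw [h, sepVec_kickAt hij hω hε.le hε2, smul_smul, inv_mul_cancel₀ hε.ne', one_smul, kickAt_apply_snd hij hω hε hε2,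
    reflectVel_smul hε.ne', reflectVel_reflectVel]

/-- The resampled normal is a unit vector whenever the pair is at distance `ε` (admissible candidates are unit; the
junk branch is the true impact vector). [folklore] -/
theorem norm_kmNormal (hε : 0 < hsDiameter σ N) {i j : Fin (N + 1)} {y : Cfg N}
    (hy : ‖geo.sepVec (y i).1 (y j).1‖ = hsDiameter σ N) (d : Die) : ‖kmNormal σ N i j y d‖ = 1 := by
  classical
  unfold kmNormal
  dsimp only
  split_ifs with h
  · exact (Nat.find_spec h).2.1
  · rw [norm_smul, norm_inv, Real.norm_eq_abs, abs_of_pos hε, hy, inv_mul_cancel₀ hε.ne']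

/-- **The pair rule of `Z*` preserves the hard-sphere domain**, for EVERY die: the sampled normal is admissible, and
the junk branch is the elastic collision (`kickAt_inv_smul_sepVec`). [folklore] -/
-- adapted from the W2 worker's `Km.kmRule_mem_hardSphereDomain` (work/stubs/stub_kickMatchedStationaryCore.lean, not landed)
theorem kmRule_mem_hardSphereDomain (hε : hsDiameter σ N ≠ 0) (i j : Fin (N + 1)) {y : Cfg N}
    (hy : y ∈ hardSphereDomain geo (N + 1) (hsDiameter σ N)) (d : Die) :
    kmRule σ N i j y d ∈ hardSphereDomain geo (N + 1) (hsDiameter σ N) := by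
  classical
  unfold kmRule kmNormal
  dsimp only
  split_ifs with h
  · exact (Nat.find_spec h).2.2.2
  · rw [kickAt_inv_smul_sepVec hε]
    exact (collidePair_mem_hardSphereDomain_iff y).2 hy

/-- **The pair rule of `Z*` leaves the resolved pair at exact contact**: `kmRule i j y d ∈ contactSet i j` for a
contact configuration `y` of the pair, every die. [folklore] -/
theorem kmRule_mem_contactSet (hε : 0 < hsDiameter σ N) (hε2 : hsDiameter σ N < 2⁻¹) {i j : Fin (N + 1)}
    (hij : i ≠ j) {y : Cfg N} (hc : y ∈ contactSet geo (N + 1) (hsDiameter σ N) i j) (d : Die) :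
    kmRule σ N i j y d ∈ contactSet geo (N + 1) (hsDiameter σ N) i j := by
  refine ⟨kmRule_mem_hardSphereDomain hε.ne' i j hc.1 d, ?_⟩
  unfold kmRule
  exact norm_sepVec_kickAt hij (norm_kmNormal hε hc.2 d) hε.le hε2 y

/-- One step of `Z*` preserves the hard-sphere domain (the exit configuration lies in the closed domain). [folklore] -/
-- adapted from the W2 worker's `Km.step_mem_hardSphereDomain` (not landed)
theorem step_kmRule_mem_hardSphereDomain (hG : geo.IsHardSphereRegular (hsDiameter σ N)) (hε : hsDiameter σ N ≠ 0)
    {z : Cfg N} (hz : z ∈ hardSphereDomain geo (N + 1) (hsDiameter σ N)) (d : Die) :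
    Driven.step geo (hsDiameter σ N) (kmRule σ N) d z ∈ hardSphereDomain geo (N + 1) (hsDiameter σ N) := by
  classical
  unfold Driven.step
  dsimp only
  split_ifs with h1 h2
  · exact hz
  · exact kmRule_mem_hardSphereDomain hε _ _ (Alexander.freeFlight_freeExitTime_mem hG hz h1) d
  · exact Alexander.freeFlight_freeExitTime_mem hG hz h1

/-- Every post-collisional state of `Z*` started in the domain lies in the domain, for every dice sequence.
[folklore] -/
-- adapted from the W2 worker's `Km.stateAfter_mem_hardSphereDomain` (not landed)
theorem stateAfter_kmRule_mem_hardSphereDomain (hG : geo.IsHardSphereRegular (hsDiameter σ N))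
    (hε : hsDiameter σ N ≠ 0) {z : Cfg N} (hz : z ∈ hardSphereDomain geo (N + 1) (hsDiameter σ N)) (u : ℕ → Die)
    (k : ℕ) : Driven.stateAfter geo (hsDiameter σ N) (kmRule σ N) u z k ∈ hardSphereDomain geo (N + 1) (hsDiameter σ N) := by
  induction k with
  | zero => exact hz
  | succ k ih => rw [Driven.stateAfter_succ]; exact step_kmRule_mem_hardSphereDomain hG hε ih (u k)

/-- An incoming contact pair at the exit configuration can be ORDERED (`i < j`): a member of `incomingPairs`.
[folklore] -/
-- adapted from the W2 worker's `Km.exists_mem_incomingPairs` (not landed)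
theorem exists_mem_incomingPairs (hG : geo.IsHardSphereRegular (hsDiameter σ N)) {y : Cfg N}
    (hy : y ∈ hardSphereDomain geo (N + 1) (hsDiameter σ N))
    (hτ : Alexander.freeExitTime geo (hsDiameter σ N) y ≠ ∞) :
    ∃ p, p ∈ Alexander.incomingPairs geo (hsDiameter σ N)
      (freeFlight geo (Alexander.freeExitTime geo (hsDiameter σ N) y).toReal y) := by
  obtain ⟨i, j, hij, hc, hin⟩ := Alexander.exists_isIncoming_freeFlight_freeExitTime hG hy hτ
  rcases lt_or_gt_of_ne hij with h | h
  · exact ⟨(i, j), h, hc, hin⟩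
  · exact ⟨(j, i), h, hG.mem_contactSet_comm.1 hc, (hG.isIncoming_comm hc.2.le).2 hin⟩

/-- **(H4) holds for `Z*` surely**: every collision of `Z*` that happens leaves the resolved pair in contact, for every
datum in the domain and every dice sequence (`0 < ε < 1/2`). [folklore] -/
theorem exists_stateAfter_succ_mem_contactSet (hε : 0 < hsDiameter σ N) (hε2 : hsDiameter σ N < 2⁻¹) {z : Cfg N}
    (hz : z ∈ hardSphereDomain geo (N + 1) (hsDiameter σ N)) (u : ℕ → Die) (k : ℕ)
    (hτ : Alexander.freeExitTime geo (hsDiameter σ N) (Driven.stateAfter geo (hsDiameter σ N) (kmRule σ N) u z k) ≠ ∞) :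
    ∃ i j : Fin (N + 1), i ≠ j ∧
      Driven.stateAfter geo (hsDiameter σ N) (kmRule σ N) u z (k + 1) ∈ contactSet geo (N + 1) (hsDiameter σ N) i j := by
  classical
  have hG : geo.IsHardSphereRegular (hsDiameter σ N) := Torus.isHardSphereRegular_geometry hε2
  have hzk := stateAfter_kmRule_mem_hardSphereDomain hG hε.ne' hz u k
  obtain ⟨p, hp⟩ := exists_mem_incomingPairs hG hzk hτ
  have hne : (Alexander.incomingPairs geo (hsDiameter σ N) (freeFlight geo (Alexander.freeExitTime geo (hsDiameter σ N)
      (Driven.stateAfter geo (hsDiameter σ N) (kmRule σ N) u z k)).toReal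
      (Driven.stateAfter geo (hsDiameter σ N) (kmRule σ N) u z k))).Nonempty := ⟨p, hp⟩
  obtain ⟨hlt, hc, -⟩ := Alexander.mem_incomingPairs.1 hne.some_mem
  refine ⟨hne.some.1, hne.some.2, hlt.ne, ?_⟩
  rw [Driven.stateAfter_succ, Driven.step, if_neg hτ]
  dsimp only
  rw [dif_pos hne]
  exact kmRule_mem_contactSet hε hε2 hlt.ne hc (u k)

/-- **The collision sum of the defect along `Z*` is a finite sum over collision indices**: for a datum in the
domain and off contact and a dice sequence whose orbit is regular ((H1) no accumulation, (H2) no grazing touch inside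
a flight, (H3) no two collisions at one instant), `Kc[F] = ε/(N+1) ∑_{k < count τ}` (summand at `(t_{k+1}, z_{k+1})`).
[folklore] -/
theorem collSum_kmFlow_eq_sum (hε : 0 < hsDiameter σ N) (hε2 : hsDiameter σ N < 2⁻¹) {u : ℕ → Die} {z : Cfg N}
    (hz : z ∈ hardSphereDomain geo (N + 1) (hsDiameter σ N))
    (hz0 : ∀ i j : Fin (N + 1), i ≠ j → z ∉ contactSet geo (N + 1) (hsDiameter σ N) i j)
    (hacc : ∀ t : ℝ, ∃ k, ENNReal.ofReal t < Driven.instant geo (hsDiameter σ N) (kmRule σ N) u z k)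
    (hgraz : ∀ (k : ℕ) (t : ℝ), 0 < t →
      ENNReal.ofReal t < Alexander.freeExitTime geo (hsDiameter σ N) (Driven.stateAfter geo (hsDiameter σ N) (kmRule σ N) u z k) →
      ∀ i j : Fin (N + 1), i ≠ j →
        freeFlight geo t (Driven.stateAfter geo (hsDiameter σ N) (kmRule σ N) u z k) ∉ contactSet geo (N + 1) (hsDiameter σ N) i j)
    (hsep : ∀ k, 0 < Alexander.freeExitTime geo (hsDiameter σ N) (Driven.stateAfter geo (hsDiameter σ N) (kmRule σ N) u z (k + 1)))
    (τ : ℝ) (F : ℝ → Fin (N + 1) → Fin (N + 1) → ℝ) :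
    collSum σ N τ (kmFlow σ N u z) F =
      hsDiameter σ N / (N + 1 : ℝ) *
        ∑ k ∈ Finset.range (Driven.count geo (hsDiameter σ N) (kmRule σ N) u z τ),
          ∑ i : Fin (N + 1), ∑ j : Fin (N + 1),
            (if i ≠ j ∧ ‖geo.sepVec ((Driven.stateAfter geo (hsDiameter σ N) (kmRule σ N) u z (k + 1)) i).1
                ((Driven.stateAfter geo (hsDiameter σ N) (kmRule σ N) u z (k + 1)) j).1‖ = hsDiameter σ N then
              F (Driven.instant geo (hsDiameter σ N) (kmRule σ N) u z (k + 1)).toReal i j else 0) := by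
  have hG : geo.IsHardSphereRegular (hsDiameter σ N) := Torus.isHardSphereRegular_geometry hε2
  have h0 : 0 < Alexander.freeExitTime geo (hsDiameter σ N) z :=
    Alexander.freeExitTime_pos hG hz fun i j hij hc _ => hz0 i j hij hc
  have hcont := fun k hτ => exists_stateAfter_succ_mem_contactSet hε hε2 hz u k hτ
  have hflow : kmFlow σ N u z = Driven.flow geo (hsDiameter σ N) (kmRule σ N) u z := rfl
  unfold collSum
  rw [hflow, Driven.finsum_mem_collisionTimes_flow_inter_Icc hacc hgraz hsep hcont h0 hz0 τ]
  refine congrArg (HMul.hMul (hsDiameter σ N / (N + 1 : ℝ))) (Finset.sum_congr rfl fun k hk => ?_)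
  have hfin : Driven.instant geo (hsDiameter σ N) (kmRule σ N) u z (k + 1) ≠ ∞ :=
    Driven.instant_ne_top_of_le_count hacc (Nat.succ_le_of_lt (Finset.mem_range.1 hk))
  rw [Driven.flow_toReal_instant hsep hfin (Or.inl k.succ_pos)]

/-- The same rewriting for the `Z*` path `starPath σ N q` of a datum/dice pair. [folklore] -/
theorem collSum_starPath_eq_sum (hε : 0 < hsDiameter σ N) (hε2 : hsDiameter σ N < 2⁻¹) {q : Cfg N × (ℕ → Die)}
    (hz : q.1 ∈ hardSphereDomain geo (N + 1) (hsDiameter σ N))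
    (hz0 : ∀ i j : Fin (N + 1), i ≠ j → q.1 ∉ contactSet geo (N + 1) (hsDiameter σ N) i j)
    (hacc : ∀ t : ℝ, ∃ k, ENNReal.ofReal t < Driven.instant geo (hsDiameter σ N) (kmRule σ N) q.2 q.1 k)
    (hgraz : ∀ (k : ℕ) (t : ℝ), 0 < t →
      ENNReal.ofReal t < Alexander.freeExitTime geo (hsDiameter σ N) (Driven.stateAfter geo (hsDiameter σ N) (kmRule σ N) q.2 q.1 k) →
      ∀ i j : Fin (N + 1), i ≠ j →
        freeFlight geo t (Driven.stateAfter geo (hsDiameter σ N) (kmRule σ N) q.2 q.1 k) ∉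
          contactSet geo (N + 1) (hsDiameter σ N) i j)
    (hsep : ∀ k, 0 < Alexander.freeExitTime geo (hsDiameter σ N)
      (Driven.stateAfter geo (hsDiameter σ N) (kmRule σ N) q.2 q.1 (k + 1)))
    (τ : ℝ) (F : ℝ → Fin (N + 1) → Fin (N + 1) → ℝ) :
    collSum σ N τ (starPath σ N q) F =
      hsDiameter σ N / (N + 1 : ℝ) *
        ∑ k ∈ Finset.range (Driven.count geo (hsDiameter σ N) (kmRule σ N) q.2 q.1 τ),
          ∑ i : Fin (N + 1), ∑ j : Fin (N + 1),
            (if i ≠ j ∧ ‖geo.sepVec ((Driven.stateAfter geo (hsDiameter σ N) (kmRule σ N) q.2 q.1 (k + 1)) i).1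
                ((Driven.stateAfter geo (hsDiameter σ N) (kmRule σ N) q.2 q.1 (k + 1)) j).1‖ = hsDiameter σ N then
              F (Driven.instant geo (hsDiameter σ N) (kmRule σ N) q.2 q.1 (k + 1)).toReal i j else 0) :=
  collSum_kmFlow_eq_sum hε hε2 hz hz0 hacc hgraz hsep τ F

/-- At a SIMPLE contact (the ordered contact pairs of `z` are exactly `(i, j)` and `(j, i)`) the inline double sum
of a collision functional reduces to the two ordered pairs (`sum_contactPairs_eq`, `Finset.sum_pair`). [folklore] -/
theorem sum_sum_ite_eq_of_contactPairs_eq_pair {M : Type*} [AddCommMonoid M] {z : Cfg N}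
    (hz : z ∈ hardSphereDomain geo (N + 1) (hsDiameter σ N)) {i j : Fin (N + 1)} (hij : i ≠ j)
    (h : contactPairs geo (hsDiameter σ N) z = {(i, j), (j, i)}) (f : Fin (N + 1) → Fin (N + 1) → M) :
    (∑ i' : Fin (N + 1), ∑ j' : Fin (N + 1),
        if i' ≠ j' ∧ ‖geo.sepVec (z i').1 (z j').1‖ = hsDiameter σ N then f i' j' else 0) = f i j + f j i := by
  rw [← sum_contactPairs_eq hz, h, Finset.sum_pair]
  intro he
  exact hij (Prod.mk.inj he).1

/-- **Finitely many collision times in `[0, τ]` along `Z*`** under (H1)–(H3) (the hypothesis of the three-piece split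
`defect_eq_pieces`). [folklore] -/
theorem finite_collisionTimes_kmFlow_inter_Icc (hε : 0 < hsDiameter σ N) (hε2 : hsDiameter σ N < 2⁻¹) {u : ℕ → Die}
    {z : Cfg N} (hz : z ∈ hardSphereDomain geo (N + 1) (hsDiameter σ N))
    (hz0 : ∀ i j : Fin (N + 1), i ≠ j → z ∉ contactSet geo (N + 1) (hsDiameter σ N) i j)
    (hacc : ∀ t : ℝ, ∃ k, ENNReal.ofReal t < Driven.instant geo (hsDiameter σ N) (kmRule σ N) u z k)
    (hgraz : ∀ (k : ℕ) (t : ℝ), 0 < t →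
      ENNReal.ofReal t < Alexander.freeExitTime geo (hsDiameter σ N) (Driven.stateAfter geo (hsDiameter σ N) (kmRule σ N) u z k) →
      ∀ i j : Fin (N + 1), i ≠ j →
        freeFlight geo t (Driven.stateAfter geo (hsDiameter σ N) (kmRule σ N) u z k) ∉ contactSet geo (N + 1) (hsDiameter σ N) i j)
    (hsep : ∀ k, 0 < Alexander.freeExitTime geo (hsDiameter σ N) (Driven.stateAfter geo (hsDiameter σ N) (kmRule σ N) u z (k + 1)))
    (τ : ℝ) : (collisionTimes geo (hsDiameter σ N) (kmFlow σ N u z) ∩ Icc 0 τ).Finite := by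
  have hG : geo.IsHardSphereRegular (hsDiameter σ N) := Torus.isHardSphereRegular_geometry hε2
  have h0 : 0 < Alexander.freeExitTime geo (hsDiameter σ N) z :=
    Alexander.freeExitTime_pos hG hz fun i j hij hc _ => hz0 i j hij hc
  exact Driven.finite_collisionTimes_flow_inter_Icc hacc hgraz hsep
    (fun k hτ => exists_stateAfter_succ_mem_contactSet hε hε2 hz u k hτ) h0 hz0 τ

end KickMatchedHardSphereGas

end Literature.MathematicalPhysics.KineticTheory

end
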